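import Literature.NumberTheory.Sieve.MontgomeryVaughan1975Lemma43Assembly
import Literature.NumberTheory.LFunctions.LogFreeDensityTheorem14Zeta
import Literature.NumberTheory.LFunctions.ExplicitFormulaPsiCharProofs
import Literature.NumberTheory.LFunctions.ExplicitFormulaPsiProofs
import HarnessLib

/-!
# Gallagher's prime number theorem WITHOUT the Deuring–Heilbronn phenomenon: the sum of
# Lemma 4.3 over the NON-exceptional characters, from the explicit formulae and the log-free
# zero-density estimate alone — PROVED assembly

H. L. Montgomery, R. C. Vaughan, *The exceptional set in Goldbach's problem*, Acta Arith. 27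
(1975), §4 Lemma 4.3 = P. X. Gallagher, *A large sieve density estimate near `σ = 1`*, Invent.
Math. 11 (1970), Theorem 7, §5.

The tree's `lemma43At_of_explicitFormula_of_density` (`MontgomeryVaughan1975Lemma43Assembly.lean`)
proves Lemma 4.3 (4.2) — INCLUDING the corrected term of the exceptional character `χ̃` and the
saving `(1 − β̃) log P` — from the truncated explicit formulae and the log-free zero-density
estimate WITH the Deuring–Heilbronn factor (hypotheses `hDH`, `hDHζ`). Many consumers of
Gallagher's theorem (the primes `p ≡ a (mod q)` for moduli `q` NOT divisible by the exceptional
conductor `r̃`: Linnik's theorem off the exceptional modulus, Adleman–Pomerance–Rumely's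
Proposition 10, McCurley's theorem) only need the part of (4.2) in which `χ̃` does not occur at
all. For that part the Deuring–Heilbronn phenomenon is NOT needed: every zero in the box
`q ≤ P`, `|γ| ≤ P⁶` of a primitive character OTHER than `χ̃` has `Re ρ ≤ 1 − c/log P` (Page's
theorem, `boxZero_re_le_of_exceptional`), the zeros of `ζ` likewise (`exists_zeta_no_boxZero`), and
the first part of Bombieri's Théorème 14 (hypotheses `hZD`, `hZDζ`, now theorems of the tree:
`Literature.NumberTheory.LFunctions.LogFreeDensity.logFreeDensity_dirichlet`,
`Literature.NumberTheory.LFunctions.LogFreeDensity.logFreeDensity_zeta`) bounds their number.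
This file proves exactly that (`gallagher_nonexceptional_of_explicitFormula_of_density`): with
`∑#` the term of Lemma 4.3 WITHOUT correction (`gallagherTerm`),

* if no exceptional datum occurs at level `c₁`:
  `∑_{q ≤ P} ∑*_{χ} (h + N/P)⁻¹ ‖∑#‖ ≤ C exp(−c₁ log N/log P)`;
* if `(r̃, χ̃, β̃)` is exceptional at level `c₁`:
  `∑_{q ≤ P} ∑*_{χ ≠ χ̃} (h + N/P)⁻¹ ‖∑#‖ ≤ C exp(−c₁ log N/log P)`,

for `2 ≤ N`, `exp(log^{1/2} N) ≤ P ≤ N^{c₄}`, arbitrary `x, h ≤ N` — the argument of branch (a) of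
the tree's assembly run over the family with `χ̃` removed (its set of zeros replaced by `∅` in the
density input). The unconditional corollary `gallagher_nonexceptional` feeds in the four inputs
from the tree.

## References

* P. X. Gallagher, Invent. Math. 11 (1970) 329–339, Theorem 7 and §5 [Gallagher1970].
* H. L. Montgomery, R. C. Vaughan, Acta Arith. 27 (1975) 353–370, §4 Lemmas 4.1, 4.3
  [MontgomeryVaughanActa1975].
* E. Bombieri, *Le grand crible dans la théorie analytique des nombres*, Astérisque 18 (1987), §6
  Théorème 14 (first part) [Bombieri1987GrandCrible].
-/

noncomputable section

open Finset Real

namespace Literature.NumberTheory.Sieve.MontgomeryVaughan1975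

open Literature.NumberTheory.LFunctions

-- one long assembly proof with a large context (a variant of
-- `lemma43At_of_explicitFormula_of_density`): the default heartbeat budget is too small
set_option maxHeartbeats 1000000 in
open scoped Classical in
/-- **Gallagher's Theorem 7 over the non-exceptional characters, from the explicit formulae and
the log-free zero-density estimate (first part only).** Assume (i) MV I Theorem 12.10
(`truncatedExplicitFormula_psiChar`) and Theorem 12.5 (`truncatedExplicitFormula_psi`); (ii) the
log-free zero-density estimate at height `P⁶` for `ζ` and for the primitive `χ` mod `q`,
`2 ≤ q ≤ P`, over arbitrary finite sets of zeros in the boxes. Then there are absolute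
`c₁, c₄ > 0`, `C` such that for `2 ≤ N`, `exp(log^{1/2} N) ≤ P ≤ N^{c₄}` and any `x, h ≤ N`:
if no exceptional datum occurs at level `c₁` then
`∑_{q ≤ P} ∑*_χ (h + N/P)⁻¹ ‖∑#_{x−h<p≤x} χ(p) log p‖ ≤ C exp(−c₁ log N/log P)`, and if
`(r̃, χ̃, β̃)` is exceptional at level `c₁` the same bound holds for the sum over the primitive
`χ ≠ χ̃` (same modulus and same values as `χ̃` excluded), the terms `∑#` being the UNCORRECTED
ones (`gallagherTerm`). No Deuring–Heilbronn input.
[cite: Gallagher1970, Theorem 7] [cite: MontgomeryVaughanActa1975, §4 Lemma 4.3 (4.2)] -/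
theorem gallagher_nonexceptional_of_explicitFormula_of_density
    (hEF : truncatedExplicitFormula_psiChar) (hEFζ : truncatedExplicitFormula_psi)
    {c_D C_D : ℝ} (hcD : 0 < c_D) (hCD : 0 < C_D)
    (hZDζ : ∀ P : ℝ, 2 ≤ P → ∀ α : ℝ, 0 ≤ α → α ≤ 1 →
      ∑ ρ ∈ (weilZeroIndex_finite (P ^ 6)).toFinset with α ≤ ρ.re,
        ((riemannZetaZeroOrder ρ : ℤ) : ℝ) ≤ C_D * P ^ (c_D * (1 - α)))
    (hZD : ∀ P : ℝ, 2 ≤ P → ∀ Z : (q : ℕ) → DirichletCharacter ℂ q → Finset ℂ,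
      (∀ (q' : ℕ) (χ : DirichletCharacter ℂ (q' + 1)), ∀ ρ ∈ Z (q' + 1) χ,
          χ.LFunction ρ = 0 ∧ 0 < ρ.re ∧ ρ.re < 1 ∧ |ρ.im| ≤ P ^ 6) →
      ∀ α : ℝ, 0 ≤ α → α ≤ 1 →
        ∑ q' ∈ Finset.Ico 1 ⌊P⌋₊, ∑ χ : DirichletCharacter ℂ (q' + 1) with χ.IsPrimitive,
          ∑ ρ ∈ Z (q' + 1) χ with α ≤ ρ.re, (DirichletDisc.zeroOrder χ ρ : ℝ) ≤
            C_D * P ^ (c_D * (1 - α))) :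
    ∃ c₁ : ℝ, 0 < c₁ ∧ ∃ c₄ : ℝ, 0 < c₄ ∧ ∃ C : ℝ,
    ∀ (N : ℕ) (P : ℝ), 2 ≤ N → Real.exp (Real.sqrt (Real.log N)) ≤ P → P ≤ (N : ℝ) ^ c₄ →
      ∀ (x h : (q : ℕ) → DirichletCharacter ℂ q → ℕ),
        (∀ q χ, x q χ ≤ N) → (∀ q χ, h q χ ≤ N) →
        ((∀ (r : ℕ) [NeZero r] (χ : DirichletCharacter ℂ r) (β : ℝ), ¬ IsExceptionalZero c₁ P r χ β) →
          ∑ q ∈ Icc 1 ⌊P⌋₊, ∑ χ : DirichletCharacter ℂ q with χ.IsPrimitive,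
              ((h q χ : ℝ) + N / P)⁻¹ * ‖gallagherTerm χ (x q χ) (h q χ)‖ ≤
            C * Real.exp (-c₁ * Real.log N / Real.log P)) ∧
        (∀ (r : ℕ) [NeZero r] (χe : DirichletCharacter ℂ r) (β : ℝ), IsExceptionalZero c₁ P r χe β →
          ∑ q ∈ Icc 1 ⌊P⌋₊, ∑ χ : DirichletCharacter ℂ q with
              (χ.IsPrimitive ∧ ¬ (q = r ∧ ∀ n : ℕ, χ (n : ZMod q) = χe (n : ZMod r))),
              ((h q χ : ℝ) + N / P)⁻¹ * ‖gallagherTerm χ (x q χ) (h q χ)‖ ≤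
            C * Real.exp (-c₁ * Real.log N / Real.log P)) := by
  classical
  -- absolute constants
  obtain ⟨K, hK0, HK⟩ := exists_block_bound_char hEF
  obtain ⟨Cζ, hCζ0, HCζ⟩ := exists_block_bound_zeta hEFζ
  obtain ⟨c_b, hcb, Hbox⟩ := exists_boxZero_isExceptional
  obtain ⟨c_z, hcz, Hzeta⟩ := exists_zeta_no_boxZero
  obtain ⟨c_P, hcP, H41⟩ := lemma41At_of_lt
  -- the level `c`
  set c : ℝ := min (min (c_b / 10) (c_z / 10)) (min (c_P / 2) (1 / 2)) with hcdef
  have hc0 : 0 < c := lt_min (lt_min (by positivity) (by positivity)) (lt_min (by positivity) (by norm_num))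
  have hc_b : 9 * c ≤ c_b := by
    have : c ≤ c_b / 10 := (min_le_left _ _).trans (min_le_left _ _)
    linarith
  have hc_z : c * (6 + 3) ≤ c_z := by
    have : c ≤ c_z / 10 := (min_le_left _ _).trans (min_le_right _ _)
    linarith
  have hc_P : c < c_P := by
    have : c ≤ c_P / 2 := (min_le_right _ _).trans (min_le_left _ _)
    linarith
  have hc2 : c ≤ 1 / 2 := (min_le_right _ _).trans (min_le_right _ _)
  have hc1 : c ≤ 1 := by linarith
  -- `c₄ = min(1/20, 1/(6 + 2c_D))`
  set c₄ : ℝ := min (1 / 20) (1 / (6 + 2 * c_D)) with hc₄def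
  have hc₄0 : 0 < c₄ := lt_min (by norm_num) (by positivity)
  have hc₄20 : c₄ ≤ 1 / 20 := min_le_left _ _
  have hc₄D : c₄ ≤ 1 / (6 + 2 * c_D) := min_le_right _ _
  set M₀ : ℝ := 100 + 200 * K + 200 * Cζ with hM₀def
  have hM₀0 : 0 ≤ M₀ := by positivity
  set Cfin : ℝ := 3 + 10 * C_D * Real.exp (c * (5 + c_D)) + M₀ with hCfin
  have hCfin0 : 0 < Cfin := by positivity
  refine ⟨c, hc0, c₄, hc₄0, Cfin, fun N P hN2 hPexp hPN x h hx hh => ?_⟩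
  have hP1' : 1 ≤ P := le_trans (Real.one_le_exp (Real.sqrt_nonneg _)) hPexp
  have hP0 : 0 < P := by linarith
  have hlogP0 : 0 ≤ Real.log P := Real.log_nonneg hP1'
  have hE0 : 0 < Real.exp (-c * Real.log N / Real.log P) := Real.exp_pos _
  -- the ranges
  obtain ⟨-, h20, hP4, hPN', hP7, hP5, hlog2, hlog4⟩ := range_facts hN2 hc₄0 hc₄20 hPexp hPN
  have hP2 : 2 ≤ P := by linarith
  obtain ⟨-, hu₀2, hu₀N, hu₀lo, hu₀hi, hBu₀⟩ := scale_facts hN2 hP2 hcD hc₄D hPN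
  have hbudget := error_budget_le hN2 hP4 hPN' hP7 hP5 hlog2 hlog4 hK0 hCζ0
  set u₀ : ℕ := ⌈(N : ℝ) / P ^ 5⌉₊ with hu₀def
  set T : ℝ := P ^ 6 with hTdef
  have hT6 : P ^ (6 : ℝ) = T := by rw [hTdef]; exact_mod_cast Real.rpow_natCast P 6
  have hT2 : 2 ≤ T := by
    rw [hTdef]
    calc (2 : ℝ) ≤ 2 ^ 6 := by norm_num
      _ ≤ P ^ 6 := pow_le_pow_left₀ (by norm_num) hP2 6
  have hT0 : 0 < T := by linarith
  have hN2r : (2 : ℝ) ≤ N := by exact_mod_cast hN2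
  have hN0 : (0 : ℝ) < N := by linarith
  have hlogP : 0 < Real.log P := by linarith
  have hlogN0 : 0 ≤ Real.log (N : ℝ) := Real.log_nonneg (by linarith)
  have hLN : Real.log N ≤ Real.log P ^ 2 := by
    have hs : Real.sqrt (Real.log N) ≤ Real.log P := by
      have := Real.log_le_log (Real.exp_pos _) hPexp
      rwa [Real.log_exp] at this
    calc Real.log (N : ℝ) = Real.sqrt (Real.log N) ^ 2 := (Real.sq_sqrt hlogN0).symm
      _ ≤ Real.log P ^ 2 := pow_le_pow_left₀ (Real.sqrt_nonneg _) hs 2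
  have hfloorP : 1 ≤ ⌊P⌋₊ := Nat.le_floor (by exact_mod_cast hP1')
  have hfloorle : (⌊P⌋₊ : ℝ) ≤ P := Nat.floor_le hP0.le
  -- the parameters of the density lemma
  set B : ℝ := P ^ c_D with hBdef
  set η : ℝ := c / Real.log P with hηdef
  have hB1 : 1 ≤ B := Real.one_le_rpow hP1' hcD.le
  have hu₀1 : (1 : ℝ) < u₀ := by
    have : (2 : ℝ) ≤ u₀ := by exact_mod_cast hu₀2
    linarith
  have hη1 : η ≤ 1 := by
    rw [hηdef, div_le_one hlogP]; linarith
  have hη0 : 0 ≤ η := div_nonneg hc0.le hlogP.le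
  have hsaving : (B / u₀) ^ η ≤ Real.exp (c * (5 + c_D)) * Real.exp (-c * Real.log N / Real.log P) :=
    saving_le hN0 (by linarith) hc0.le hu₀lo
  -- the error budget
  set E : ℝ := 2 * Real.sqrt N * Real.log N + 2 * Real.log (N + 1) +
    K * (Real.log N + N / T * Real.log (P * N * T) ^ 2) with hEdef
  set Eζ : ℝ := 2 * Real.sqrt N * Real.log N + 2 * Real.log N + 1 +
    Cζ * (Real.log N + N / T * Real.log (N * T) ^ 2) with hEζdef
  have hlogN1 : 0 ≤ Real.log ((N : ℝ) + 1) := Real.log_nonneg (by linarith)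
  have hlog40 : 0 ≤ Real.log 4 := Real.log_nonneg (by norm_num)
  have hEnn : 0 ≤ E := by rw [hEdef]; positivity
  have hEζnn : 0 ≤ Eζ := by rw [hEζdef]; positivity
  have hu₀r0 : (0 : ℝ) ≤ u₀ := Nat.cast_nonneg _
  have hbudget' : 2 * P ^ 3 / N * ((Real.log 4 + 2) * u₀ + E + Eζ + 1) ≤ M₀ / P ^ 2 := by
    refine le_trans ?_ (hbudget.trans_eq (by rw [hM₀def]))
    apply mul_le_mul_of_nonneg_left _ (by positivity)
    have h3 : 0 ≤ Real.log 4 + 2 := by linarith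
    linarith [mul_le_mul_of_nonneg_left hu₀hi h3]
  -- the uniform per-pair error and its sum over the pairs
  set err : ℝ := P / N * ((Real.log 4 + 2) * u₀ + E + Eζ + 1) with herrdef
  have herr0 : 0 ≤ err := by rw [herrdef]; positivity
  have hpairs : err * (1 + ∑ q' ∈ Ico 1 ⌊P⌋₊, ((q' : ℝ) + 1)) ≤ M₀ / P ^ 2 := by
    have h1 : 1 + ∑ q' ∈ Ico 1 ⌊P⌋₊, ((q' : ℝ) + 1) ≤ 2 * P ^ 2 := by
      have := sum_Ico_succ_le_sq hfloorle
      have hP21 : (1 : ℝ) ≤ P ^ 2 := one_le_pow₀ hP1'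
      linarith
    calc err * (1 + ∑ q' ∈ Ico 1 ⌊P⌋₊, ((q' : ℝ) + 1)) ≤ err * (2 * P ^ 2) :=
          mul_le_mul_of_nonneg_left h1 herr0
      _ = 2 * P ^ 3 / N * ((Real.log 4 + 2) * u₀ + E + Eζ + 1) := by
          rw [herrdef]; ring
      _ ≤ M₀ / P ^ 2 := hbudget'
  -- the finite sets of zeros
  set Zfin : (q : ℕ) → DirichletCharacter ℂ q → Finset ℂ := fun q χ =>
    if hq : q = 0 then ∅ else
      haveI : NeZero q := ⟨hq⟩
      if hχ : χ = 1 then ∅ else (lfunctionZeroBox_finite hχ T).toFinset with hZfin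
  have hZfin_eq : ∀ (q' : ℕ) (χ : DirichletCharacter ℂ (q' + 1)) (hχ : χ ≠ 1),
      Zfin (q' + 1) χ = (lfunctionZeroBox_finite hχ T).toFinset := by
    intro q' χ hχ
    simp only [hZfin]
    rw [dif_neg (Nat.succ_ne_zero q'), dif_neg hχ]
  have hZfin_mem : ∀ (q' : ℕ) (χ : DirichletCharacter ℂ (q' + 1)), ∀ ρ ∈ Zfin (q' + 1) χ,
      χ.LFunction ρ = 0 ∧ 0 < ρ.re ∧ ρ.re < 1 ∧ |ρ.im| ≤ P ^ 6 := by
    intro q' χ ρ hρ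
    by_cases hχ : χ = 1
    · subst hχ; simp [hZfin] at hρ
    · rw [hZfin_eq q' χ hχ] at hρ
      exact mem_toFinset_lfunctionZeroBox hχ hρ
  -- primitive characters mod `q' + 1 ≥ 2` are non-principal
  have hne1 : ∀ (q' : ℕ), 1 ≤ q' → ∀ (χ : DirichletCharacter ℂ (q' + 1)), χ.IsPrimitive → χ ≠ 1 := by
    intro q' hq' χ hprim hχ
    subst hχ
    have := eq_one_of_isPrimitive_one hprim
    omega
  -- reindex the sum over `q`
  have hsplit : ∀ F : ℕ → ℝ, ∑ q ∈ Icc 1 ⌊P⌋₊, F q = F 1 + ∑ q' ∈ Ico 1 ⌊P⌋₊, F (q' + 1) :=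
    fun F => sum_Icc_one_eq F hfloorP
  -- the zeros of `ζ` in the box (the classical zero-free region: no exceptional zero for `ζ`)
  set Sζ := (weilZeroIndex_finite T).toFinset with hSζ
  have hζre : ∀ ρ ∈ Sζ, ρ.re ≤ 1 - η := by
    intro ρ hρ
    obtain ⟨h0, -, -, -, h4, -⟩ := mem_toFinset_weilZeroIndex hρ
    have := Hzeta 6 (by norm_num) c P hc0 hc_z hP2 ρ h0 (by rw [hT6]; exact h4)
    rwa [hηdef]
  have hζpos : ∀ ρ ∈ Sζ, 0 ≤ ρ.re := fun ρ hρ => (mem_toFinset_weilZeroIndex hρ).2.1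
  have hζw : ∀ ρ ∈ Sζ, 0 ≤ ((riemannZetaZeroOrder ρ : ℤ) : ℝ) := fun ρ hρ =>
    (mem_toFinset_weilZeroIndex hρ).2.2.2.2.2.2.2
  set Uζ : ℝ := ∑ ρ ∈ Sζ, ((riemannZetaZeroOrder ρ : ℤ) : ℝ) * (u₀ : ℝ) ^ (ρ.re - 1) with hUζdef
  have hUζ0 : 0 ≤ Uζ := Finset.sum_nonneg fun ρ hρ => by
    have := hζw ρ hρ; positivity
  have hUζ : Uζ ≤ 5 * C_D * (B / u₀) ^ η := by
    refine sum_mul_rpow_sub_one_le_of_density₀ Sζ (fun ρ => ρ.re)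
      (fun ρ => ((riemannZetaZeroOrder ρ : ℤ) : ℝ)) hu₀1 hB1 hBu₀ hCD.le hη1 hζw hζpos hζre ?_
    intro α' hα'0 hα'1
    have h := hZDζ P hP2 α' hα'0 (by linarith)
    rw [hBdef, ← Real.rpow_mul hP0.le]
    exact h
  -- the `q = 1` term: one character, `ζ`
  have hcard1 : (((univ : Finset (DirichletCharacter ℂ 1)).filter fun χ => χ.IsPrimitive).card : ℝ) ≤ 1 := by
    have := card_filter_isPrimitive_le_self 1
    exact this.trans_eq (by norm_num)
  have hterm1 : ∀ χ : DirichletCharacter ℂ 1,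
      ((h 1 χ : ℝ) + N / P)⁻¹ * ‖gallagherTerm χ (x 1 χ) (h 1 χ)‖ ≤ Uζ + err := by
    intro χ
    have := weighted_gallagherTerm_modOne_le hCζ0 HCζ hP2 hT2 χ hu₀2 hu₀N (hx 1 χ) (h := h 1 χ)
    refine this.trans (add_le_add le_rfl ?_)
    rw [herrdef]
    apply mul_le_mul_of_nonneg_left _ (by positivity)
    rw [hEζdef]
    linarith
  ------------------------------------------------------------------
  -- the core: the sum over any sub-family `F` of the primitive characters all of whose zeros in
  -- the box have `Re ρ ≤ 1 − η`
  have core : ∀ F : (q : ℕ) → Finset (DirichletCharacter ℂ q),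
      (∀ (q : ℕ) (χ : DirichletCharacter ℂ q), χ ∈ F q → χ.IsPrimitive) →
      (∀ q' ∈ Ico 1 ⌊P⌋₊, ∀ χ ∈ F (q' + 1), ∀ ρ ∈ Zfin (q' + 1) χ, ρ.re ≤ 1 - η) →
      ∑ q ∈ Icc 1 ⌊P⌋₊, ∑ χ ∈ F q, ((h q χ : ℝ) + N / P)⁻¹ * ‖gallagherTerm χ (x q χ) (h q χ)‖ ≤
        Cfin * Real.exp (-c * Real.log N / Real.log P) := by
    intro F hFprim hre
    have hsubF : ∀ q : ℕ, F q ⊆ (univ : Finset (DirichletCharacter ℂ q)).filter fun χ => χ.IsPrimitive :=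
      fun q χ hχ => Finset.mem_filter.mpr ⟨Finset.mem_univ _, hFprim q χ hχ⟩
    -- the sets of zeros with the zeros of the characters outside `F` removed
    set Z' : (q : ℕ) → DirichletCharacter ℂ q → Finset ℂ := fun q χ =>
      if χ ∈ F q then Zfin q χ else ∅ with hZ'
    have hZ'_mem : ∀ (q' : ℕ) (χ : DirichletCharacter ℂ (q' + 1)), ∀ ρ ∈ Z' (q' + 1) χ,
        χ.LFunction ρ = 0 ∧ 0 < ρ.re ∧ ρ.re < 1 ∧ |ρ.im| ≤ P ^ 6 := by
      intro q' χ ρ hρ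
      by_cases hm : χ ∈ F (q' + 1)
      · simp only [hZ', if_pos hm] at hρ
        exact hZfin_mem q' χ ρ hρ
      · simp [hZ', hm] at hρ
    -- the zero sums over the sub-family
    have hUsum : ∑ q' ∈ Ico 1 ⌊P⌋₊, ∑ χ ∈ F (q' + 1),
        ∑ ρ ∈ Zfin (q' + 1) χ, (DirichletDisc.zeroOrder χ ρ : ℝ) * (u₀ : ℝ) ^ (ρ.re - 1) ≤
          5 * C_D * (B / u₀) ^ η := by
      refine sum_sum_sum_mul_rpow_le_of_density₀ (Ico 1 ⌊P⌋₊) (fun q' => F (q' + 1))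
        (fun q' χ => Zfin (q' + 1) χ) (fun q' χ ρ => (DirichletDisc.zeroOrder χ ρ : ℝ))
        hu₀1 hB1 hBu₀ hCD.le hη1 (fun _ _ _ _ _ _ => Nat.cast_nonneg _)
        (fun q' _ χ _ ρ hρ => (hZfin_mem q' χ ρ hρ).2.1.le) hre ?_
      intro α' hα'0 hα'1
      have hd := hZD P hP2 Z' hZ'_mem α' hα'0 (by linarith)
      rw [hBdef, ← Real.rpow_mul hP0.le]
      refine le_trans (le_of_eq ?_) hd
      refine Finset.sum_congr rfl fun q' _ => ?_
      calc ∑ χ ∈ F (q' + 1), ∑ ρ ∈ (Zfin (q' + 1) χ).filter (fun ρ => α' ≤ ρ.re),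
            (DirichletDisc.zeroOrder χ ρ : ℝ)
          = ∑ χ ∈ ((univ : Finset (DirichletCharacter ℂ (q' + 1))).filter
              (fun χ => χ.IsPrimitive)).filter (fun χ => χ ∈ F (q' + 1)),
              ∑ ρ ∈ (Zfin (q' + 1) χ).filter (fun ρ => α' ≤ ρ.re),
                (DirichletDisc.zeroOrder χ ρ : ℝ) := by
            rw [Finset.filter_mem_eq_inter, Finset.inter_eq_right.mpr (hsubF (q' + 1))]
        _ = ∑ χ ∈ (univ : Finset (DirichletCharacter ℂ (q' + 1))).filter (fun χ => χ.IsPrimitive),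
              if χ ∈ F (q' + 1) then ∑ ρ ∈ (Zfin (q' + 1) χ).filter (fun ρ => α' ≤ ρ.re),
                (DirichletDisc.zeroOrder χ ρ : ℝ) else 0 := Finset.sum_filter _ _
        _ = _ := by
            refine Finset.sum_congr rfl fun χ _ => ?_
            by_cases hm : χ ∈ F (q' + 1)
            · simp only [if_pos hm, hZ']
            · simp only [if_neg hm, hZ']
              simp
    -- the terms with `q' + 1 ≥ 2`
    have hterm : ∀ q' ∈ Ico 1 ⌊P⌋₊, ∀ χ ∈ F (q' + 1),
        ((h (q' + 1) χ : ℝ) + N / P)⁻¹ * ‖gallagherTerm χ (x (q' + 1) χ) (h (q' + 1) χ)‖ ≤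
          (∑ ρ ∈ Zfin (q' + 1) χ, (DirichletDisc.zeroOrder χ ρ : ℝ) * (u₀ : ℝ) ^ (ρ.re - 1)) + err := by
      intro q' hq' χ hχ
      rw [Finset.mem_Ico] at hq'
      have hprim := hFprim _ χ hχ
      have hχ1 := hne1 q' hq'.1 χ hprim
      have hqP : ((q' + 1 : ℕ) : ℝ) ≤ P := by
        have : ((q' + 1 : ℕ) : ℝ) ≤ ⌊P⌋₊ := by exact_mod_cast hq'.2
        exact this.trans hfloorle
      have hq2 : 1 < q' + 1 := by omega
      have := weighted_gallagherTerm_le hK0 HK hP2 hT2 hq2 hqP hprim hχ1 hu₀2 hu₀N (hx (q' + 1) χ)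
        (h := h (q' + 1) χ)
      rw [hZfin_eq q' χ hχ1]
      refine this.trans (add_le_add le_rfl ?_)
      rw [herrdef]
      apply mul_le_mul_of_nonneg_left _ (by positivity)
      rw [hEdef]
      linarith
    have hcard : ∀ q' : ℕ, ((F (q' + 1)).card : ℝ) ≤ (q' : ℝ) + 1 := by
      intro q'
      have h1 : (F (q' + 1)).card ≤
          ((univ : Finset (DirichletCharacter ℂ (q' + 1))).filter fun χ => χ.IsPrimitive).card :=
        Finset.card_le_card (hsubF (q' + 1))
      have h2 := card_filter_isPrimitive_le_self (q' + 1)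
      push_cast at h2
      exact le_trans (by exact_mod_cast h1) h2
    have hsum2 : ∑ q' ∈ Ico 1 ⌊P⌋₊, ∑ χ ∈ F (q' + 1),
        ((h (q' + 1) χ : ℝ) + N / P)⁻¹ * ‖gallagherTerm χ (x (q' + 1) χ) (h (q' + 1) χ)‖ ≤
        5 * C_D * (B / u₀) ^ η + err * ∑ q' ∈ Ico 1 ⌊P⌋₊, ((q' : ℝ) + 1) := by
      calc _ ≤ ∑ q' ∈ Ico 1 ⌊P⌋₊, ∑ χ ∈ F (q' + 1),
            ((∑ ρ ∈ Zfin (q' + 1) χ, (DirichletDisc.zeroOrder χ ρ : ℝ) * (u₀ : ℝ) ^ (ρ.re - 1)) + err) :=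
            Finset.sum_le_sum fun q' hq' => Finset.sum_le_sum fun χ hχ => hterm q' hq' χ hχ
        _ = (∑ q' ∈ Ico 1 ⌊P⌋₊, ∑ χ ∈ F (q' + 1),
              ∑ ρ ∈ Zfin (q' + 1) χ, (DirichletDisc.zeroOrder χ ρ : ℝ) * (u₀ : ℝ) ^ (ρ.re - 1)) +
            ∑ q' ∈ Ico 1 ⌊P⌋₊, ∑ χ ∈ F (q' + 1), err := by
            rw [← Finset.sum_add_distrib]
            refine Finset.sum_congr rfl fun q' _ => ?_
            rw [Finset.sum_add_distrib]
        _ ≤ 5 * C_D * (B / u₀) ^ η + err * ∑ q' ∈ Ico 1 ⌊P⌋₊, ((q' : ℝ) + 1) := by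
            refine add_le_add hUsum ?_
            rw [Finset.mul_sum]
            refine Finset.sum_le_sum fun q' _ => ?_
            rw [Finset.sum_const, nsmul_eq_mul]
            calc _ ≤ ((q' : ℝ) + 1) * err := mul_le_mul_of_nonneg_right (hcard q') herr0
              _ = err * ((q' : ℝ) + 1) := mul_comm _ _
    -- the `q = 1` term of the restricted sum
    have hsum1 : ∑ χ ∈ F 1, ((h 1 χ : ℝ) + N / P)⁻¹ * ‖gallagherTerm χ (x 1 χ) (h 1 χ)‖ ≤ Uζ + err := by
      have hcard1' : ((F 1).card : ℝ) ≤ 1 := by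
        refine le_trans ?_ hcard1
        exact_mod_cast Finset.card_le_card (hsubF 1)
      calc _ ≤ ((F 1).card : ℝ) * (Uζ + err) := by
            rw [← nsmul_eq_mul]
            exact Finset.sum_le_card_nsmul _ _ _ fun χ _ => hterm1 χ
        _ ≤ 1 * (Uζ + err) := mul_le_mul_of_nonneg_right hcard1' (by positivity)
        _ = Uζ + err := one_mul _
    -- assemble
    rw [hsplit (fun q => ∑ χ ∈ F q, ((h q χ : ℝ) + N / P)⁻¹ * ‖gallagherTerm χ (x q χ) (h q χ)‖)]
    have hinvsq : (P ^ 2)⁻¹ ≤ Real.exp (-c * Real.log N / Real.log P) :=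
      inv_sq_le_exp_neg hP1' hc1 hlogN0 hLN
    calc _ ≤ (Uζ + err) + (5 * C_D * (B / u₀) ^ η + err * ∑ q' ∈ Ico 1 ⌊P⌋₊, ((q' : ℝ) + 1)) :=
          add_le_add hsum1 hsum2
      _ = (Uζ + 5 * C_D * (B / u₀) ^ η) + err * (1 + ∑ q' ∈ Ico 1 ⌊P⌋₊, ((q' : ℝ) + 1)) := by ring
      _ ≤ 10 * C_D * (B / u₀) ^ η + M₀ / P ^ 2 := by linarith [hUζ, hpairs]
      _ ≤ 10 * C_D * (Real.exp (c * (5 + c_D)) * Real.exp (-c * Real.log N / Real.log P)) +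
            M₀ * Real.exp (-c * Real.log N / Real.log P) := by
          refine add_le_add (mul_le_mul_of_nonneg_left hsaving (by positivity)) ?_
          rw [div_eq_mul_inv]
          exact mul_le_mul_of_nonneg_left hinvsq hM₀0
      _ ≤ Cfin * Real.exp (-c * Real.log N / Real.log P) := by
          rw [hCfin]
          have : 0 ≤ 3 * Real.exp (-c * Real.log N / Real.log P) := by positivity
          linarith [this]
  ------------------------------------------------------------------
  refine ⟨fun hnone => ?_, fun r _ χe β hEZ => ?_⟩
  · -- (a) no exceptional datum at level `c`: the whole family
    refine core _ (fun q χ hχ => (Finset.mem_filter.mp hχ).2) (fun q' hq' χ hχ ρ hρ => ?_)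
    rw [Finset.mem_Ico] at hq'
    have hprim : χ.IsPrimitive := (Finset.mem_filter.mp hχ).2
    have hχ1 := hne1 q' hq'.1 χ hprim
    obtain ⟨hL, -, -, him⟩ := hZfin_mem q' χ ρ hρ
    have hqP : ((q' + 1 : ℕ) : ℝ) ≤ P := by
      have : ((q' + 1 : ℕ) : ℝ) ≤ ⌊P⌋₊ := by exact_mod_cast hq'.2
      exact this.trans hfloorle
    have := boxZero_re_le_of_none Hbox hc0 hc_b hP2 hnone hprim hχ1 hqP hL (by rw [hT6]; exact him)
    rwa [hηdef]
  · -- (b) the exceptional datum `(r, χe, β)` at level `c`: the family without `χe`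
    have h41 : Lemma41At c P := H41 c P hc0 hc_P hP4
    refine core _ (fun q χ hχ => (Finset.mem_filter.mp hχ).2.1) (fun q' hq' χ hχ ρ hρ => ?_)
    rw [Finset.mem_Ico] at hq'
    obtain ⟨-, hprim, hEx⟩ := Finset.mem_filter.mp hχ
    have hχ1 := hne1 q' hq'.1 χ hprim
    obtain ⟨hL, -, -, him⟩ := hZfin_mem q' χ ρ hρ
    have hqP : ((q' + 1 : ℕ) : ℝ) ≤ P := by
      have : ((q' + 1 : ℕ) : ℝ) ≤ ⌊P⌋₊ := by exact_mod_cast hq'.2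
      exact this.trans hfloorle
    have hne : ¬ (q' + 1 = r ∧ (∀ n : ℕ, χ (n : ZMod (q' + 1)) = χe (n : ZMod r)) ∧
        ρ = ((β : ℝ) : ℂ)) := fun hh => hEx ⟨hh.1, hh.2.1⟩
    have := boxZero_re_le_of_exceptional Hbox hc0 hc_b hP2 h41 hEZ hprim hχ1 hqP hL
      (by rw [hT6]; exact him) hne
    rwa [hηdef]

open scoped Classical in
/-- **Gallagher's Theorem 7 over the non-exceptional characters — UNCONDITIONAL.** The inputs of
`gallagher_nonexceptional_of_explicitFormula_of_density` are theorems of the tree: the truncated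
explicit formulae (`truncatedExplicitFormula_psiChar_holds`, `truncatedExplicitFormula_psi_holds`)
and the first part of Bombieri's Théorème 14 for `ζ` and for the primitive characters
(`LogFreeDensity.logFreeDensity_zeta`, `LogFreeDensity.logFreeDensity_dirichlet`).
[cite: Gallagher1970, Theorem 7] [cite: MontgomeryVaughanActa1975, §4 Lemma 4.3 (4.2)]
[cite: Bombieri1987GrandCrible, §6 Théorème 14] -/
theorem gallagher_nonexceptional :
    ∃ c₁ : ℝ, 0 < c₁ ∧ ∃ c₄ : ℝ, 0 < c₄ ∧ ∃ C : ℝ,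
    ∀ (N : ℕ) (P : ℝ), 2 ≤ N → Real.exp (Real.sqrt (Real.log N)) ≤ P → P ≤ (N : ℝ) ^ c₄ →
      ∀ (x h : (q : ℕ) → DirichletCharacter ℂ q → ℕ),
        (∀ q χ, x q χ ≤ N) → (∀ q χ, h q χ ≤ N) →
        ((∀ (r : ℕ) [NeZero r] (χ : DirichletCharacter ℂ r) (β : ℝ), ¬ IsExceptionalZero c₁ P r χ β) →
          ∑ q ∈ Icc 1 ⌊P⌋₊, ∑ χ : DirichletCharacter ℂ q with χ.IsPrimitive,
              ((h q χ : ℝ) + N / P)⁻¹ * ‖gallagherTerm χ (x q χ) (h q χ)‖ ≤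
            C * Real.exp (-c₁ * Real.log N / Real.log P)) ∧
        (∀ (r : ℕ) [NeZero r] (χe : DirichletCharacter ℂ r) (β : ℝ), IsExceptionalZero c₁ P r χe β →
          ∑ q ∈ Icc 1 ⌊P⌋₊, ∑ χ : DirichletCharacter ℂ q with
              (χ.IsPrimitive ∧ ¬ (q = r ∧ ∀ n : ℕ, χ (n : ZMod q) = χe (n : ZMod r))),
              ((h q χ : ℝ) + N / P)⁻¹ * ‖gallagherTerm χ (x q χ) (h q χ)‖ ≤
            C * Real.exp (-c₁ * Real.log N / Real.log P)) := by
  classical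
  obtain ⟨c_D, C_D, hcD, hCD, hZD⟩ := LogFreeDensity.logFreeDensity_dirichlet
  obtain ⟨c_D', C_D', hcD', hCD', hZDζ⟩ := LogFreeDensity.logFreeDensity_zeta
  -- common exponent and constant
  have key := gallagher_nonexceptional_of_explicitFormula_of_density
    truncatedExplicitFormula_psiChar_holds truncatedExplicitFormula_psi_holds
    (c_D := max c_D c_D') (C_D := max C_D C_D') (by positivity) (by positivity) ?_ ?_
  · exact key
  · intro P hP α hα0 hα1
    refine (hZDζ P hP α hα0 hα1).trans ?_
    refine mul_le_mul (le_max_right _ _) ?_ (by positivity) (by positivity)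
    exact Real.rpow_le_rpow_of_exponent_le (by linarith)
      (mul_le_mul_of_nonneg_right (le_max_right _ _) (by linarith))
  · intro P hP Z hZ α hα0 hα1
    refine (hZD P hP Z hZ α hα0 hα1).trans ?_
    refine mul_le_mul (le_max_left _ _) ?_ (by positivity) (by positivity)
    exact Real.rpow_le_rpow_of_exponent_le (by linarith)
      (mul_le_mul_of_nonneg_right (le_max_left _ _) (by linarith))

end Literature.NumberTheory.Sieve.MontgomeryVaughan1975
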